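import Literature.Analysis.ODE.SchrodingerDirichlet
import Mathlib.MeasureTheory.Integral.ExpDecay
import HarnessLib

/-!
# A bound state below a test Rayleigh quotient for `-u'' + W u` on the line

Topic `Literature/Analysis/ODE` (namespace `Literature.Analysis.ODE`), concluding the chain
`SchrodingerODE` → `SchrodingerSturm` → `SchrodingerDirichlet`. The classical variational
principle for the bottom of the spectrum of a one-dimensional Schrödinger operator
`H = -d²/ds² + W` with bounded continuous potential, in the elementary ODE form needed by
`Literature.Barriers.FinalStateConjecture.GregoryLaflammeNegativeEigenfunction` (Collingbourne,
J. Math. Phys. 62 (2021) 032502, Prop. 4.3 / Cor. 4.4 / proof of Prop. 4.6), proved WITHOUT Sobolev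
spaces: **if `E'` lies strictly below `lim inf_{|s| → ∞} W` and some `C¹` function `ψ` with
`ψ, ψ' ∈ L²` has Rayleigh quotient `∫ (ψ'² + W ψ²) / ∫ ψ² < E'`, then `H` has an eigenvalue `E ≤ E'`
with a positive classical eigenfunction `u`, `u'' = (W - E) u`, decaying exponentially together
with `u'`** (`exists_boundState_of_rayleigh`). Everything is proved.

Proof (Hartman, *Ordinary Differential Equations*, Ch. XI §6: disconjugacy, the variational
principle Thm. 6.2, and the construction of principal solutions as limits of solutions vanishing
at the endpoint of growing intervals, Cor. 6.4 and Exercise 6.8): by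
`exists_shooting_eigenpair_of_rayleigh`, every large interval `[-R, R]` carries `E_R ∈ [-B-1, E']`
and a solution `v_R > 0` on `[-R, R)` of `v'' = (W - E_R) v` with `v_R(-R) = v_R'(-R) = 1`,
`v_R(R) = 0`. Where `W - E' ≥ c > 0` (i.e. for `|s|` large) these solutions obey UNIFORM exponential
bounds (`shooting_decay_right/left`: convexity and the energy `v'² - c v²`). Normalising the data
at `s = 0` to the unit circle and extracting a convergent subsequence of `(E_R, data)`
(Bolzano–Weierstrass), the solution `u` of the limiting initial value problem is the pointwise
limit of the normalised `v_R` together with its derivative (continuous dependence,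
`IsSchrodingerSol.dist_phase_le_param`); hence `u ≥ 0`, `u ≢ 0` (so `u > 0`), and the uniform
bounds pass to the limit: `|u|, |u'| ≤ C e^{-√c |s|}`.

## References

* P. Hartman, *Ordinary Differential Equations*, Classics in Applied Mathematics 38 (SIAM 2002),
  Ch. XI §6 (Thm. 6.2, Cor. 6.4 and its proof, Exercise 6.8). Key `Hartman2002`.
* S. C. Collingbourne, J. Math. Phys. 62 (2021) 032502 = arXiv:2007.08441, Prop. 4.3, Cor. 4.4,
  proof of Prop. 4.6 (p. 22). Key `Collingbourne2021`.
-/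

noncomputable section

open Set Metric Filter MeasureTheory
open scoped NNReal Topology

namespace Literature.Analysis.ODE

/-! ## Uniform exponential bounds for the shooting solutions -/

/-- **Right tail of a shooting solution.** Let `v'' = q v` with `q ≥ c > 0` on `[S, R]`, `v > 0` on
`[S, R)` and `v R = 0`. Then on `[S, R]`: `v' ≤ 0` and `v s ≤ v S · e^{-√c (s - S)}` (the solution is
convex, so `v'` increases to `v'(R) ≤ 0`; the energy `v'² - c v²` decreases to `v'(R)² ≥ 0`, whence
`-v' ≥ √c v`; cf. Hartman Ch. XI, Cor. 6.4 and Exercise 6.8: the solutions `u_T` with `u_T(T) = 0`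
approximating the principal solution `u₀ > 0`, `u₀' ≤ 0`). [cite: Hartman2002, Ch. XI Cor. 6.4 and Exercise 6.8] -/
theorem shooting_decay_right {q v : ℝ → ℝ} (hv : IsSchrodingerSol q v) {c S R : ℝ} (hc : 0 < c)
    (hSR : S < R) (hq : ∀ s ∈ Icc S R, c ≤ q s) (hpos : ∀ s ∈ Ico S R, 0 < v s) (hvR : v R = 0) :
    ∀ s ∈ Icc S R, deriv v s ≤ 0 ∧ v s ≤ v S * Real.exp (-Real.sqrt c * (s - S)) := by
  have hnn : ∀ s ∈ Icc S R, 0 ≤ v s := fun s hs => by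
    rcases eq_or_lt_of_le hs.2 with h | h
    · rw [h, hvR]
    · exact (hpos s ⟨hs.1, h⟩).le
  have hmono : MonotoneOn (deriv v) (Icc S R) := hv.monotoneOn_deriv fun s hs =>
    mul_nonneg ((hc.le.trans (hq s (Ioo_subset_Icc_self hs)))) (hnn s (Ioo_subset_Icc_self hs))
  -- `v' < 0` on `[S, R)` by the mean value theorem, `v' R ≤ 0` by continuity
  have hneg : ∀ t ∈ Ico S R, deriv v t < 0 := by
    intro t ht
    obtain ⟨ξ, hξ, hslope⟩ := exists_hasDerivAt_eq_slope v (deriv v) ht.2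
      hv.continuous.continuousOn (fun s _ => hv.hasDerivAt s)
    have hξneg : deriv v ξ < 0 := by
      rw [hslope, hvR, zero_sub]
      exact div_neg_of_neg_of_pos (neg_neg_of_pos (hpos t ht)) (sub_pos.2 ht.2)
    exact lt_of_le_of_lt (hmono (Ico_subset_Icc_self ht) ⟨ht.1.trans hξ.1.le, hξ.2.le⟩ hξ.1.le) hξneg
  have hR0 : deriv v R ≤ 0 := by
    have ht : Tendsto (deriv v) (𝓝[<] R) (𝓝 (deriv v R)) :=
      tendsto_nhdsWithin_of_tendsto_nhds (hv.continuous_deriv.tendsto R)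
    refine le_of_tendsto ht ?_
    filter_upwards [Ioo_mem_nhdsLT hSR] with t ht'
    exact (hneg t ⟨ht'.1.le, ht'.2⟩).le
  have hle0 : ∀ s ∈ Icc S R, deriv v s ≤ 0 := fun s hs => by
    rcases eq_or_lt_of_le hs.2 with h | h
    · rw [h]; exact hR0
    · exact (hneg s ⟨hs.1, h⟩).le
  -- energy
  have hanti := hv.energy_antitoneOn (c := c) hnn hle0 hq
  have hineq : ∀ s ∈ Icc S R, deriv v s ≤ -Real.sqrt c * v s := by
    intro s hs
    have hE : deriv v R ^ 2 - c * v R ^ 2 ≤ deriv v s ^ 2 - c * v s ^ 2 :=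
      hanti hs (right_mem_Icc.2 hSR.le) hs.2
    rw [hvR] at hE
    have hsq : c * v s ^ 2 ≤ deriv v s ^ 2 := by nlinarith [sq_nonneg (deriv v R)]
    have h := sqrt_mul_abs_le_abs_of_sq_le hc.le hsq
    rw [abs_of_nonneg (hnn s hs), abs_of_nonpos (hle0 s hs)] at h
    linarith
  have hexp := le_mul_exp_of_deriv_le (fun s _ => hv.hasDerivAt s) hineq
  exact fun s hs => ⟨hle0 s hs, hexp s hs⟩

/-- **Left tail of a shooting solution.** Let `v'' = q v` with `c ≤ q` on `[a, S]` where
`0 < c ≤ 1`, and `v a > 0`, `v' a = v a`. Then on `[a, S]`: `0 < v`, `0 ≤ v'` and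
`v s ≤ v S · e^{-√c (S - s)}` (positivity propagation; the energy `v'² - c v²` increases from
`v(a)² (1 - c) ≥ 0`, whence `v' ≥ √c v`; Hartman Ch. XI, proof of Cor. 6.4: the solution with
`u(a) = 1`, `u'(a) = 1` is convex with `u' ≥ 1`). [cite: Hartman2002, Ch. XI Cor. 6.4 (proof)] -/
theorem shooting_decay_left {q v : ℝ → ℝ} (hv : IsSchrodingerSol q v) {c a S : ℝ} (hc : 0 < c)
    (hc1 : c ≤ 1) (hq : ∀ s ∈ Icc a S, c ≤ q s) (h0 : 0 < v a) (h1 : deriv v a = v a) :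
    ∀ s ∈ Icc a S, 0 < v s ∧ 0 ≤ deriv v s ∧ v s ≤ v S * Real.exp (-Real.sqrt c * (S - s)) := by
  have hq0 : ∀ s ∈ Icc a S, 0 ≤ q s := fun s hs => hc.le.trans (hq s hs)
  have h1' : 0 ≤ deriv v a := by rw [h1]; exact h0.le
  have hpos := hv.pos_of_nonneg_coeff hq0 h0 h1'
  have hder : ∀ s ∈ Icc a S, 0 ≤ deriv v s := fun s hs =>
    h1'.trans (hv.deriv_le_deriv_of_nonneg_coeff hq0 h0 h1' s hs)
  have hmono := hv.energy_monotoneOn (c := c) (fun s hs => (hpos s hs).le) hder hq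
  have hineq : ∀ s ∈ Icc a S, Real.sqrt c * v s ≤ deriv v s := by
    intro s hs
    have hE : deriv v a ^ 2 - c * v a ^ 2 ≤ deriv v s ^ 2 - c * v s ^ 2 :=
      hmono (left_mem_Icc.2 (hs.1.trans hs.2)) hs hs.1
    rw [h1] at hE
    have hsq : c * v s ^ 2 ≤ deriv v s ^ 2 := by nlinarith [sq_nonneg (v a)]
    have h := sqrt_mul_abs_le_abs_of_sq_le hc.le hsq
    rwa [abs_of_nonneg (hpos s hs).le, abs_of_nonneg (hder s hs)] at h
  have hexp := le_mul_exp_of_le_deriv (fun s _ => hv.hasDerivAt s) hineq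
  exact fun s hs => ⟨hpos s hs, hder s hs, hexp s hs⟩

/-! ## Integrability from exponential tails -/

/-- A continuous function with exponentially decaying tails is integrable on `ℝ`. [folklore] -/
theorem integrable_of_continuous_of_exp_tails {f : ℝ → ℝ} (hf : Continuous f) {κ C T : ℝ}
    (hκ : 0 < κ) (hp : ∀ s, T ≤ s → |f s| ≤ C * Real.exp (-κ * s))
    (hm : ∀ s, s ≤ -T → |f s| ≤ C * Real.exp (κ * s)) : Integrable f := by
  have hmeas : AEStronglyMeasurable f volume := hf.aestronglyMeasurable
  -- right tail
  have I₁ : IntegrableOn f (Ici T) := by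
    rw [integrableOn_Ici_iff_integrableOn_Ioi]
    refine Integrable.mono' (((exp_neg_integrableOn_Ioi T hκ).const_mul C)) hmeas.restrict ?_
    filter_upwards [ae_restrict_mem measurableSet_Ioi] with s hs
    rw [Real.norm_eq_abs]
    exact hp s (le_of_lt hs)
  -- left tail, by reflection
  have I₂ : IntegrableOn f (Iic (-T)) := by
    rw [integrableOn_Iic_iff_integrableOn_Iio]
    have hg : IntegrableOn (fun s => C * Real.exp (κ * s)) (Iio (-T)) := by
      have h := (exp_neg_integrableOn_Ioi T hκ).comp_neg
      rw [neg_Ioi] at h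
      have h' : IntegrableOn (fun s => Real.exp (κ * s)) (Iio (-T)) :=
        h.congr_fun (fun s _ => by simp only [neg_mul_neg]) measurableSet_Iio
      exact h'.const_mul C
    refine Integrable.mono' hg hmeas.restrict ?_
    filter_upwards [ae_restrict_mem measurableSet_Iio] with s hs
    rw [Real.norm_eq_abs]
    exact hm s (le_of_lt hs)
  -- compact middle
  have I₃ : IntegrableOn f (Icc (-T) T) := hf.integrableOn_Icc
  have hU : Iic (-T) ∪ Icc (-T) T ∪ Ici T = univ := by
    ext s
    simp only [mem_union, mem_Iic, mem_Icc, mem_Ici, mem_univ, iff_true]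
    rcases le_or_gt s (-T) with h | h
    · exact Or.inl (Or.inl h)
    rcases le_or_gt T s with h' | h'
    · exact Or.inr h'
    · exact Or.inl (Or.inr ⟨h.le, h'.le⟩)
  have := (I₂.union I₃).union I₁
  rwa [hU, integrableOn_univ] at this

/-! ## The bound state -/

/-- **A bound state below a test Rayleigh quotient (the variational principle for the ground
state, ODE form).** Let `W : ℝ → ℝ` be continuous with `|W| ≤ B`, and let `E'` be such that
`W - E' ≥ c` outside `[Sm, Sp]` for some `0 < c ≤ 1` (i.e. `E' < lim inf_{|s|→∞} W`). If a `C¹`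
function `ψ` with `ψ², ψ'²` integrable satisfies `∫ (ψ'² + W ψ²) < E' ∫ ψ²`, then there are
`E ≤ E'` and a classical solution `u > 0` of `u'' = (W - E) u` on `ℝ` with `u², u'²` integrable
(indeed `u, u'` decay like `e^{-√c |s|}`): an `H¹` eigenfunction of `-d²/ds² + W` with eigenvalue
`E ≤ E'`. This is the statement "`E₀ := inf E(v) < 0` ⇒ a minimiser exists, solves the
Euler–Lagrange equation weakly and is smooth" of Collingbourne (Prop. 4.3, Cor. 4.4, proof of
Prop. 4.6), here obtained by Sturm–Picone shooting on `[-R, R]`, `R → ∞` (Hartman Ch. XI §6).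
[cite: Hartman2002, Ch. XI Thm. 6.2] [cite: Collingbourne2021, Prop. 4.3 and proof of Prop. 4.6] -/
theorem exists_boundState_of_rayleigh {W : ℝ → ℝ} (hW : Continuous W) {B : ℝ} (hB : ∀ s, |W s| ≤ B)
    {E' c Sp Sm : ℝ} (hc : 0 < c) (hc1 : c ≤ 1)
    (hSp : ∀ s, Sp ≤ s → c ≤ W s - E') (hSm : ∀ s, s ≤ Sm → c ≤ W s - E')
    {ψ : ℝ → ℝ} (hψ : ContDiff ℝ 1 ψ) (hL2 : Integrable (fun s => ψ s ^ 2))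
    (hL2' : Integrable (fun s => deriv ψ s ^ 2))
    (hlt : ∫ s, (deriv ψ s ^ 2 + W s * ψ s ^ 2) < E' * ∫ s, ψ s ^ 2) :
    ∃ E ≤ E', ∃ u : ℝ → ℝ, IsSchrodingerSol (fun s => W s - E) u ∧ (∀ s, 0 < u s) ∧
      Integrable (fun s => u s ^ 2) ∧ Integrable (fun s => deriv u s ^ 2) := by
  -- WLOG `Sm ≤ 0 ≤ Sp`
  set Tp : ℝ := max Sp 0 with hTp
  set Tm : ℝ := min Sm 0 with hTm
  have hTp0 : 0 ≤ Tp := le_max_right _ _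
  have hTm0 : Tm ≤ 0 := min_le_right _ _
  have hWTp : ∀ s, Tp ≤ s → c ≤ W s - E' := fun s hs => hSp s ((le_max_left _ _).trans hs)
  have hWTm : ∀ s, s ≤ Tm → c ≤ W s - E' := fun s hs => hSm s (hs.trans (min_le_left _ _))
  set κ : ℝ := Real.sqrt c with hκ
  have hκ0 : 0 < κ := Real.sqrt_pos.2 hc
  obtain ⟨R₀, hR₀, hR⟩ := exists_shooting_eigenpair_of_rayleigh hW hB hψ hL2 hL2' hlt
  -- the intervals `[-R n, R n]`
  set R : ℕ → ℝ := fun n => R₀ + Tp - Tm + 1 + n with hRdef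
  have hRn : ∀ n : ℕ, (n : ℝ) + (Tp - Tm + 1) ≤ R n := fun n => by
    simp only [hRdef]; linarith
  have hRge : ∀ n, R₀ ≤ R n := fun n => by
    have := hRn n; have := (n.cast_nonneg : (0 : ℝ) ≤ n); linarith
  have hRp : ∀ n, Tp < R n := fun n => by
    have := hRn n; have := (n.cast_nonneg : (0 : ℝ) ≤ n); linarith
  have hRm : ∀ n, -R n < Tm := fun n => by
    have := hRn n; have := (n.cast_nonneg : (0 : ℝ) ≤ n); linarith
  have hRpos : ∀ n, 0 < R n := fun n => lt_of_le_of_lt hTp0 (hRp n)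
  -- the shooting eigenpairs
  have hex : ∀ n, ∃ E : ℝ, -B - 1 ≤ E ∧ E ≤ E' ∧ ∃ v : ℝ → ℝ,
      IsSchrodingerSol (fun s => W s - E) v ∧ v (-R n) = 1 ∧ deriv v (-R n) = 1 ∧
        (∀ s ∈ Ico (-R n) (R n), 0 < v s) ∧ v (R n) = 0 := fun n => hR (R n) (hRge n)
  choose E hEge hEle v hv h0 h1 hpos hvR using hex
  -- uniform tail bounds
  have hright : ∀ n, ∀ s ∈ Icc Tp (R n), deriv (v n) s ≤ 0 ∧
      v n s ≤ v n Tp * Real.exp (-κ * (s - Tp)) := fun n =>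
    shooting_decay_right (hv n) hc (hRp n) (fun s hs => by linarith [hWTp s hs.1, hEle n])
      (fun s hs => hpos n s ⟨by linarith [hRm n, hs.1], hs.2⟩) (hvR n)
  have hleft : ∀ n, ∀ s ∈ Icc (-R n) Tm, 0 < v n s ∧ 0 ≤ deriv (v n) s ∧
      v n s ≤ v n Tm * Real.exp (-κ * (Tm - s)) := fun n =>
    shooting_decay_left (hv n) hc hc1 (fun s hs => by linarith [hWTm s hs.2, hEle n])
      (by rw [h0 n]; exact zero_lt_one) (by rw [h0 n, h1 n])
  -- normalisation of the data at `s = 0`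
  have hv0 : ∀ n, 0 < v n 0 := fun n => hpos n 0 ⟨by linarith [hRpos n], hRpos n⟩
  set N : ℕ → ℝ := fun n => Real.sqrt (v n 0 ^ 2 + deriv (v n) 0 ^ 2) with hN
  have hNpos : ∀ n, 0 < N n := fun n => Real.sqrt_pos.2 (by nlinarith [hv0 n])
  have hNsq : ∀ n, N n ^ 2 = v n 0 ^ 2 + deriv (v n) 0 ^ 2 := fun n =>
    Real.sq_sqrt (by nlinarith [hv0 n])
  set w : ℕ → ℝ → ℝ := fun n s => (N n)⁻¹ * v n s with hw
  have hwsol : ∀ n, IsSchrodingerSol (fun s => W s - E n) (w n) := fun n => (hv n).const_mul _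
  have hdw : ∀ n s, deriv (w n) s = (N n)⁻¹ * deriv (v n) s := fun n s =>
    (((hv n).hasDerivAt s).const_mul (N n)⁻¹).deriv
  have hwpos : ∀ n, ∀ s ∈ Ico (-R n) (R n), 0 < w n s := fun n s hs =>
    mul_pos (inv_pos.2 (hNpos n)) (hpos n s hs)
  have hcircle : ∀ n, w n 0 ^ 2 + deriv (w n) 0 ^ 2 = 1 := fun n => by
    rw [hdw]
    simp only [hw]
    have hN0 : N n ≠ 0 := (hNpos n).ne'
    field_simp
    linarith [hNsq n]
  have habs : ∀ n, |w n 0| ≤ 1 ∧ |deriv (w n) 0| ≤ 1 := fun n =>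
    ⟨(sq_le_one_iff_abs_le_one _).1 (by nlinarith [hcircle n, sq_nonneg (deriv (w n) 0)]),
      (sq_le_one_iff_abs_le_one _).1 (by nlinarith [hcircle n, sq_nonneg (w n 0)])⟩
  -- compactness: a convergent subsequence of `(E n, w n 0, w n' 0)`
  set K : Set (ℝ × ℝ × ℝ) := Icc (-B - 1) E' ×ˢ (Icc (-1) 1 ×ˢ Icc (-1) 1) with hK
  have hKc : IsCompact K := isCompact_Icc.prod (isCompact_Icc.prod isCompact_Icc)
  have hmem : ∀ n, (E n, w n 0, deriv (w n) 0) ∈ K := fun n =>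
    ⟨⟨hEge n, hEle n⟩, abs_le.1 (habs n).1, abs_le.1 (habs n).2⟩
  obtain ⟨⟨E₀, p₀, p₀'⟩, hmemK, φ, hφ, hlim⟩ := hKc.tendsto_subseq hmem
  have hE₀le : E₀ ≤ E' := hmemK.1.2
  have hE₀ge : -B - 1 ≤ E₀ := hmemK.1.1
  have htE : Tendsto (fun k => E (φ k)) atTop (𝓝 E₀) := (continuous_fst.tendsto _).comp hlim
  have htp : Tendsto (fun k => w (φ k) 0) atTop (𝓝 p₀) :=
    (continuous_fst.tendsto _).comp ((continuous_snd.tendsto _).comp hlim)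
  have htp' : Tendsto (fun k => deriv (w (φ k)) 0) atTop (𝓝 p₀') :=
    (continuous_snd.tendsto _).comp ((continuous_snd.tendsto _).comp hlim)
  have hcirc0 : p₀ ^ 2 + p₀' ^ 2 = 1 := by
    have h1 : Tendsto (fun k => w (φ k) 0 ^ 2 + deriv (w (φ k)) 0 ^ 2) atTop (𝓝 (p₀ ^ 2 + p₀' ^ 2)) :=
      (htp.pow 2).add (htp'.pow 2)
    have h2 : Tendsto (fun k => w (φ k) 0 ^ 2 + deriv (w (φ k)) 0 ^ 2) atTop (𝓝 1) := by
      simp only [hcircle]; exact tendsto_const_nhds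
    exact tendsto_nhds_unique h1 h2
  -- the limiting solution
  have hWE₀ : Continuous fun s => W s - E₀ := hW.sub continuous_const
  obtain ⟨u, hu, hu0, hu1⟩ := exists_isSchrodingerSol hWE₀ 0 p₀ p₀'
  -- pointwise convergence of `(w, w')` along the subsequence
  have hconv : ∀ s, Tendsto (fun k => w (φ k) s) atTop (𝓝 (u s)) ∧
      Tendsto (fun k => deriv (w (φ k)) s) atTop (𝓝 (deriv u s)) := by
    intro s
    obtain ⟨P, hP⟩ := isCompact_Icc.exists_bound_of_continuousOn
      (hu.continuous.continuousOn (s := Icc (-|s|) (|s|)))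
    set P₁ : ℝ := |P| + 1 with hP₁
    have hP' : ∀ t ∈ Icc (-|s|) (|s|), |u t| ≤ P₁ := fun t ht =>
      ((Real.norm_eq_abs _).symm.le.trans (hP t ht)).trans (by linarith [le_abs_self P])
    set M : ℝ := Real.exp ((|B| + (|B| + 1 + |E'|) + 1) * |s|) with hM
    have hbd : ∀ k, dist (w (φ k) s, deriv (w (φ k)) s) (u s, deriv u s) ≤
        (dist (w (φ k) 0, deriv (w (φ k)) 0) (p₀, p₀') + |E (φ k) - E₀| * P₁) * M := by
      intro k
      have h := (hwsol (φ k)).dist_phase_le_param hu (a := -|s|) (b := |s|) (s₀ := 0)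
        ⟨by linarith [abs_nonneg s], abs_nonneg s⟩ (fun t _ => hB t) hP' (by positivity) s
        ⟨neg_abs_le s, le_abs_self s⟩
      rw [hu0, hu1, sub_zero] at h
      refine h.trans (mul_le_mul_of_nonneg_left ?_ (by positivity))
      rw [hM, Real.exp_le_exp]
      refine mul_le_mul_of_nonneg_right ?_ (abs_nonneg s)
      have : |E (φ k)| ≤ |B| + 1 + |E'| := by
        rw [abs_le]
        constructor <;> linarith [hEge (φ k), hEle (φ k), le_abs_self B, le_abs_self E', abs_nonneg B,
          abs_nonneg E']
      linarith
    have hT0 : Tendsto (fun k => (dist (w (φ k) 0, deriv (w (φ k)) 0) (p₀, p₀') +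
        |E (φ k) - E₀| * P₁) * M) atTop (𝓝 0) := by
      have h1 : Tendsto (fun k => dist (w (φ k) 0, deriv (w (φ k)) 0) (p₀, p₀')) atTop (𝓝 0) :=
        tendsto_iff_dist_tendsto_zero.1 (htp.prodMk_nhds htp')
      have h2 : Tendsto (fun k => |E (φ k) - E₀|) atTop (𝓝 0) := by
        have := tendsto_iff_dist_tendsto_zero.1 htE
        simpa only [Real.dist_eq] using this
      have h3 := (h1.add (h2.mul_const P₁)).mul_const M
      rwa [show ((0 : ℝ) + 0 * P₁) * M = 0 by ring] at h3
    have hT : Tendsto (fun k => (w (φ k) s, deriv (w (φ k)) s)) atTop (𝓝 (u s, deriv u s)) :=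
      tendsto_iff_dist_tendsto_zero.2 (squeeze_zero (fun _ => dist_nonneg) hbd hT0)
    exact ⟨(continuous_fst.tendsto _).comp hT, (continuous_snd.tendsto _).comp hT⟩
  -- every `s` eventually lies inside `(-R (φ k), R (φ k))`
  have hev : ∀ s, ∀ᶠ k in atTop, s ∈ Ico (-R (φ k)) (R (φ k)) := by
    intro s
    have hφR : Tendsto (fun k => R (φ k)) atTop atTop := by
      refine tendsto_atTop_mono (fun k => ?_) (tendsto_natCast_atTop_atTop.comp hφ.tendsto_atTop)
      have := hRn (φ k); simp only [Function.comp_apply]; linarith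
    filter_upwards [hφR.eventually_gt_atTop |s|] with k hk
    exact ⟨by linarith [neg_abs_le s], lt_of_le_of_lt (le_abs_self s) hk⟩
  -- `u ≥ 0`, `u ≢ 0`, hence `u > 0`
  have hunn : ∀ s, 0 ≤ u s := fun s =>
    ge_of_tendsto (hconv s).1 ((hev s).mono fun k hk => (hwpos (φ k) s hk).le)
  have hune : ∃ s₁, u s₁ ≠ 0 := by
    by_contra h
    push Not at h
    have hu00 : u = fun _ => 0 := funext h
    have hp₀ : p₀ = 0 := by rw [← hu0, h 0]
    have hp₀' : p₀' = 0 := by rw [← hu1, hu00]; simp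
    rw [hp₀, hp₀'] at hcirc0
    norm_num at hcirc0
  obtain ⟨s₁, hs₁⟩ := hune
  have hupos : ∀ s, 0 < u s := hu.pos_of_nonneg hWE₀ hunn hs₁
  -- the tail bounds pass to the limit
  have hur : ∀ s, Tp ≤ s → deriv u s ≤ 0 ∧ u s ≤ u Tp * Real.exp (-κ * (s - Tp)) := by
    intro s hs
    refine ⟨le_of_tendsto (hconv s).2 ?_, le_of_tendsto_of_tendsto (hconv s).1
      ((hconv Tp).1.mul_const _) ?_⟩
    · filter_upwards [hev s] with k hk
      rw [hdw]
      exact mul_nonpos_of_nonneg_of_nonpos (inv_pos.2 (hNpos _)).le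
        (hright (φ k) s ⟨hs, hk.2.le⟩).1
    · filter_upwards [hev s] with k hk
      have h := (hright (φ k) s ⟨hs, hk.2.le⟩).2
      have := mul_le_mul_of_nonneg_left h (inv_pos.2 (hNpos (φ k))).le
      simp only [hw]
      rwa [← mul_assoc] at this
  have hul : ∀ s, s ≤ Tm → 0 ≤ deriv u s ∧ u s ≤ u Tm * Real.exp (-κ * (Tm - s)) := by
    intro s hs
    refine ⟨ge_of_tendsto (hconv s).2 ?_, le_of_tendsto_of_tendsto (hconv s).1
      ((hconv Tm).1.mul_const _) ?_⟩
    · filter_upwards [hev s] with k hk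
      rw [hdw]
      exact mul_nonneg (inv_pos.2 (hNpos _)).le (hleft (φ k) s ⟨hk.1, hs⟩).2.1
    · filter_upwards [hev s] with k hk
      have h := (hleft (φ k) s ⟨hk.1, hs⟩).2.2
      have := mul_le_mul_of_nonneg_left h (inv_pos.2 (hNpos (φ k))).le
      simp only [hw]
      rwa [← mul_assoc] at this
  -- derivative bounds from the monotonicity of `u'` on the tails
  have hqpos : ∀ s, s ≤ Tm ∨ Tp ≤ s → 0 ≤ (W s - E₀) * u s := fun s hs => by
    refine mul_nonneg ?_ (hupos s).le
    rcases hs with hs | hs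
    · linarith [hWTm s hs]
    · linarith [hWTp s hs]
  have hdr : ∀ t, Tp + 1 ≤ t → |deriv u t| ≤ u (t - 1) := by
    intro t ht
    have key := abs_deriv_le_of_monotoneOn_of_nonpos (u := u) (s := t - 1)
      (fun τ _ => hu.hasDerivAt τ)
      (hu.monotoneOn_deriv fun τ hτ => hqpos τ (Or.inr (by linarith [hτ.1])))
      (by rw [sub_add_cancel]; exact (hur t (by linarith)).1)
      (by rw [sub_add_cancel]; exact (hupos t).le)
    rwa [sub_add_cancel] at key
  have hdl : ∀ t, t ≤ Tm - 1 → |deriv u t| ≤ u (t + 1) := by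
    intro t ht
    have key := abs_deriv_le_of_monotoneOn_of_nonneg (u := u) (s := t + 1)
      (fun τ _ => hu.hasDerivAt τ)
      (hu.monotoneOn_deriv fun τ hτ => hqpos τ (Or.inl (by linarith [hτ.2])))
      (by rw [add_sub_cancel_right]; exact (hul t (by linarith)).1)
      (by rw [add_sub_cancel_right]; exact (hupos t).le)
    rwa [add_sub_cancel_right] at key
  -- exponential tails for `u²` and `u'²`
  set Cp : ℝ := u Tp * Real.exp (κ * Tp) with hCp
  set Cm : ℝ := u Tm * Real.exp (-κ * Tm) with hCm
  have hutailp : ∀ s, Tp ≤ s → u s ≤ Cp * Real.exp (-κ * s) := fun s hs => by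
    have h := (hur s hs).2
    rwa [show -κ * (s - Tp) = κ * Tp + -κ * s by ring, Real.exp_add, ← mul_assoc] at h
  have hutailm : ∀ s, s ≤ Tm → u s ≤ Cm * Real.exp (κ * s) := fun s hs => by
    have h := (hul s hs).2
    rwa [show -κ * (Tm - s) = -κ * Tm + κ * s by ring, Real.exp_add, ← mul_assoc] at h
  set T : ℝ := max (Tp + 1) (1 - Tm) with hT
  set C : ℝ := (Cp + Cm) ^ 2 * Real.exp (2 * κ) with hC
  have hCp0 : 0 ≤ Cp := mul_nonneg (hupos Tp).le (Real.exp_nonneg _)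
  have hCm0 : 0 ≤ Cm := mul_nonneg (hupos Tm).le (Real.exp_nonneg _)
  have hI : Integrable (fun s => u s ^ 2) := by
    refine integrable_of_continuous_of_exp_tails (hu.continuous.pow 2) (κ := 2 * κ) (C := C) (T := T)
      (by positivity) (fun s hs => ?_) (fun s hs => ?_)
    · have hs' : Tp ≤ s := by linarith [le_max_left (Tp + 1) (1 - Tm)]
      have h := hutailp s hs'
      rw [abs_of_nonneg (sq_nonneg _)]
      calc u s ^ 2 ≤ (Cp * Real.exp (-κ * s)) ^ 2 := pow_le_pow_left₀ (hupos s).le h 2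
        _ = Cp ^ 2 * 1 * Real.exp (-(2 * κ) * s) := by
            rw [mul_pow, ← Real.exp_nat_mul]; ring_nf
        _ ≤ (Cp + Cm) ^ 2 * Real.exp (2 * κ) * Real.exp (-(2 * κ) * s) := by
            gcongr
            · linarith
            · exact Real.one_le_exp (by positivity)
    · have hs' : s ≤ Tm := by linarith [le_max_right (Tp + 1) (1 - Tm)]
      have h := hutailm s hs'
      rw [abs_of_nonneg (sq_nonneg _)]
      calc u s ^ 2 ≤ (Cm * Real.exp (κ * s)) ^ 2 := pow_le_pow_left₀ (hupos s).le h 2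
        _ = Cm ^ 2 * 1 * Real.exp (2 * κ * s) := by
            rw [mul_pow, ← Real.exp_nat_mul]; ring_nf
        _ ≤ (Cp + Cm) ^ 2 * Real.exp (2 * κ) * Real.exp (2 * κ * s) := by
            gcongr
            · linarith
            · exact Real.one_le_exp (by positivity)
  have hI' : Integrable (fun s => deriv u s ^ 2) := by
    refine integrable_of_continuous_of_exp_tails (hu.continuous_deriv.pow 2) (κ := 2 * κ) (C := C)
      (T := T) (by positivity) (fun s hs => ?_) (fun s hs => ?_)
    · have hs' : Tp + 1 ≤ s := (le_max_left _ _).trans hs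
      have h := (hdr s hs').trans (hutailp (s - 1) (by linarith))
      rw [abs_of_nonneg (sq_nonneg _), ← sq_abs]
      calc |deriv u s| ^ 2 ≤ (Cp * Real.exp (-κ * (s - 1))) ^ 2 := pow_le_pow_left₀ (abs_nonneg _) h 2
        _ = Cp ^ 2 * Real.exp (2 * κ) * Real.exp (-(2 * κ) * s) := by
            rw [mul_pow, ← Real.exp_nat_mul, mul_assoc, ← Real.exp_add]; ring_nf
        _ ≤ (Cp + Cm) ^ 2 * Real.exp (2 * κ) * Real.exp (-(2 * κ) * s) := by
            gcongr
            linarith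
    · have hs' : s ≤ Tm - 1 := by linarith [le_max_right (Tp + 1) (1 - Tm)]
      have h := (hdl s hs').trans (hutailm (s + 1) (by linarith))
      rw [abs_of_nonneg (sq_nonneg _), ← sq_abs]
      calc |deriv u s| ^ 2 ≤ (Cm * Real.exp (κ * (s + 1))) ^ 2 := pow_le_pow_left₀ (abs_nonneg _) h 2
        _ = Cm ^ 2 * Real.exp (2 * κ) * Real.exp (2 * κ * s) := by
            rw [mul_pow, ← Real.exp_nat_mul, mul_assoc, ← Real.exp_add]; ring_nf
        _ ≤ (Cp + Cm) ^ 2 * Real.exp (2 * κ) * Real.exp (2 * κ * s) := by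
            gcongr
            linarith
  exact ⟨E₀, hE₀le, u, hu, hupos, hI, hI'⟩

end Literature.Analysis.ODE
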